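import Mathlib
import Summits.Ventures.PercRepro2.LocRows
import Summits.Ventures.PercRepro2.SwRow
import Summits.Ventures.PercRepro2.SwOut
import Summits.Ventures.PercRepro2.SwAllRow
import Summits.Ventures.PercRepro2.SwOutAll
import Summits.Ventures.PercRepro2.SwOutArmFlip
import Summits.Ventures.PercRepro2.SwOutArms
import Summits.Ventures.PercRepro2.SwOutArmOrbit
import Summits.Ventures.PercRepro2.SwOutArmCube
import Summits.Ventures.PercRepro2.SwOutArmThm
import Summits.Ventures.PercRepro2.SwOutCoreDefs
import Summits.Ventures.PercRepro2.SwOutCoreKey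
import Summits.Ventures.PercRepro2.SwOutJunctionH1Defs
import Summits.Ventures.PercRepro2.SwOutJunctionH1Arms
import Summits.Ventures.PercRepro2.SwOutJunctionH1Cover
import Summits.Ventures.PercRepro2.SwOutJunctionH1Inside
import Summits.Ventures.PercRepro2.SwOutJunctionH1Base
import Summits.Ventures.PercRepro2.SwOutJunctionH1Kinds
import Summits.Ventures.PercRepro2.SwOutBigBlockDefs
import Summits.Ventures.PercRepro2.SwOutMixedBaseDefs
import Summits.Ventures.PercRepro2.SwOutMixedBaseClasses
import Summits.Ventures.PercRepro2.SwOutMixedBaseHull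
import Summits.Ventures.PercRepro2.SwOutMixedBaseDual
import Summits.Ventures.PercRepro2.SwOutMixedCore
import Summits.Ventures.PercRepro2.SwOutMixedPartDefs
import Summits.Ventures.PercRepro2.SwOutMixedPartBase
import Summits.Ventures.PercRepro2.SwOutMixedPartCoreKey
import Summits.Ventures.PercRepro2.SwOutMixedPartKey
import Summits.Ventures.PercRepro2.SwOutMixedPartOrbitDefs
import Summits.Ventures.PercRepro2.SwOutMixedPartRed

/-!
# The non-degeneracy of a mixed block in a class, and the escaping points escape (blind cell
PercRepro2, night-4 g19, 2026-08-27; proofs/NIGHT4-G19.md §5 (iii))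

The hypotheses of the block theorem (`rigid_block`) and of (G1) (`mem_outClass_iff`) at the mixed
base of a core-kind point `ζ` of a class with a mixed single junction: a dead edge exists
(`exists_dead_edge`), `p` has an outside edge (`exists_ext_edge`), the neighbours of `p` outside
`{u}` and the h-piece are outside the region (`ext_out`: (b) puts the inside ones into the
h-piece), every vertex of the h-piece has an edge to the outside (`Ah_bdry`: the mark `o` is not
in the component of `p`, so `hout` applies), every far arm has its h-edge (`exists_edge_F`), and
the arms are connected inside themselves (`uArms_conn`, `farArms_conn`; the h-piece by the
hypothesis `AhConn`, which holds when `p` has a single partner inside the region —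
`AhOf_conn_of_unique`).  Finally, at an escaping point of the raw cube the hull of `u` leaves the
region (`not_hull_u_subset_esc`: through the outside edge of `p` on the escaping cube, through a
boundary edge of the h-piece at the antipodal pair).
-/

namespace Summit.Ventures.PercRepro2

namespace BigBlock

open Hull LocRows

variable {V : Type*} {E : Type*} [Fintype E] [DecidableEq E]

open scoped Classical

variable {ends : E → Sym2 V} {U : Set V} {ξ : Config E} {l h o u p : V}

/-- The h-piece of every core-kind point of the class is connected inside itself. -/
def AhConn (ends : E → Sym2 V) (U : Set V) (ξ : Config E) (l h o u p : V) : Prop :=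
  ∀ ζ ∈ swOutSide ends l h o U ξ, CoreKind ends U h u ζ → ∀ x ∈ AhOf ends h u p ζ,
    ∀ y ∈ AhOf ends h u p ζ,
      y ∈ cluster ends (fun e => decide (e ∈ within ends (AhOf ends h u p ζ))) x

variable (hj : MixedJunction ends U h u p o)
include hj

omit [Fintype E] [DecidableEq E] in
/-- A dead edge exists at every configuration. -/
lemma exists_dead_edge (ζ : Config E) : ∃ e y, ends e = s(p, y) ∧ y ∈ AhOf ends h u p ζ := by
  obtain ⟨e, y, hey, hyU, hyu⟩ := hj.hp_nbr
  obtain ⟨e', hye⟩ := hj.hp_adj_h e y hey hyU hyu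
  have hyh : y ≠ h := by
    rintro rfl
    exact hj.hnadj_p e (ends_swap hey)
  have hyp : y ≠ p := by
    rintro rfl
    exact hj.hloop_p e hey
  have hyH : y ∈ extHull ends ζ h u := by
    cases hc : ζ e' with
    | true => exact Or.inl (Or.inl (mem_cluster_of_edge (mem_cluster_self _ _ _) hc (ends_swap hye)))
    | false =>
      have hc' : blue ζ e' = true := by rw [blue_eq_true_iff]; exact hc
      exact Or.inl (Or.inr (mem_cluster_of_edge (mem_cluster_self _ _ _) hc' (ends_swap hye)))
  exact ⟨e, y, hey, mem_armC_of_edge (mem_armC_self p) (p_mem_extHull hj.hup ζ) hj.hne_hp.symm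
    hj.hne_up.symm hyH hyh hyu hey, hyp⟩

/-- The neighbours of `p` outside `{u}` and the h-piece lie outside the region (core kind). -/
lemma ext_out {ζ : Config E} (hζ : ζ ∈ swOutSide ends l h o U ξ) (hk : CoreKind ends U h u ζ) :
    ∀ e x, ends e = s(p, x) → x ≠ u → x ∉ AhOf ends h u p ζ → x ∉ U := by
  intro e x hxe hxu hxA hxU
  obtain ⟨e', hxh⟩ := hj.hp_adj_h e x hxe hxU hxu
  have hxh' : x ≠ h := by
    rintro rfl
    exact hj.hnadj_p e (ends_swap hxe)
  have hxp : x ≠ p := by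
    rintro rfl
    exact hj.hloop_p e hxe
  have hxH : x ∈ extHull ends ζ h u := by
    cases hc : ζ e' with
    | true => exact Or.inl (Or.inl (mem_cluster_of_edge (mem_cluster_self _ _ _) hc (ends_swap hxh)))
    | false =>
      have hc' : blue ζ e' = true := by rw [blue_eq_true_iff]; exact hc
      exact Or.inl (Or.inr (mem_cluster_of_edge (mem_cluster_self _ _ _) hc' (ends_swap hxh)))
  have := extHull_subset_of_coreKind hζ hk
  exact hxA ⟨mem_armC_of_edge (mem_armC_self p) (p_mem_extHull hj.hup ζ) hj.hne_hp.symm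
    hj.hne_up.symm hxH hxh' hxu hxe, hxp⟩

/-- `p` has an outside edge (core kind). -/
lemma exists_ext_edge {ζ : Config E} (hζ : ζ ∈ swOutSide ends l h o U ξ)
    (hk : CoreKind ends U h u ζ) : ∃ e, e ∈ clsExt ends u p (AhOf ends h u p ζ) := by
  have hHU := extHull_subset_of_coreKind hζ hk
  have hpU : p ∈ U := hHU (p_mem_extHull hj.hup ζ)
  have huU : u ∈ U := hHU (Or.inr (Or.inl (mem_cluster_self _ _ _)))
  rcases hj.hout p hpU hj.hne_hp.symm hj.hop.symm hj.hne_up.symm with ⟨e, y, hey, hyU⟩ | hiso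
  · refine ⟨e, y, hey, fun hyu => hyU (hyu ▸ huU), fun hyA => ?_⟩
    exact hyU (hHU (armsC_subset (armP_mem_armsC hj ζ) y hyA.1).1)
  · exfalso
    obtain ⟨e, he⟩ := hj.hup
    exact hiso e (by rw [he]; exact Sym2.mem_mk_right u p)

/-- Every vertex of the h-piece has an edge to the outside (core kind; `o` not in the component
of `p`). -/
lemma Ah_bdry (ho : o ∉ compU ends U h u p) {ζ : Config E} (hζ : ζ ∈ swOutSide ends l h o U ξ)
    (hk : CoreKind ends U h u ζ) :
    ∀ y ∈ AhOf ends h u p ζ, ∃ e z, ends e = s(y, z) ∧ z ≠ h ∧ z ≠ u ∧ z ≠ p ∧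
      z ∉ armsAll (fun P : uArms ends h u p ζ => P.1) (AhOf ends h u p ζ)
        (fun P : farArms ends h u p ζ => P.1) ∧ z ∉ U := by
  intro y hy
  have hHU := extHull_subset_of_coreKind hζ hk
  have hAP := armP_mem_armsC hj ζ
  obtain ⟨hyH, hyh, hyu⟩ := armsC_subset hAP y hy.1
  have hyU : y ∈ U := hHU hyH
  have hyo : y ≠ o := by
    rintro rfl
    exact ho (armC_subset_compU hHU p hy.1)
  rcases hj.hout y hyU hyh hyo hyu with ⟨e, z, hyz, hzU⟩ | hiso
  · refine ⟨e, z, hyz, ?_, ?_, ?_, ?_, hzU⟩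
    · rintro rfl; exact hzU (hHU (Or.inl (Or.inl (mem_cluster_self _ _ _))))
    · rintro rfl; exact hzU (hHU (Or.inr (Or.inl (mem_cluster_self _ _ _))))
    · rintro rfl; exact hzU (hHU (p_mem_extHull hj.hup ζ))
    · intro hz; exact hzU (hHU (mem_extHull_of_mem_armsAll hj hz).1)
  · exfalso
    obtain ⟨e, hye⟩ := exists_edge_of_mem_cluster (h := p) hy.1 hy.2
    exact hiso e hye

/-- Every far arm carries an h-edge. -/
lemma exists_edge_F {ζ : Config E} (hζ : ζ ∈ swOutSide ends l h o U ξ)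
    (hk : CoreKind ends U h u ζ) (P : farArms ends h u p ζ) : ∃ e, e ∈ touches ends P.1 := by
  obtain ⟨e, y, hey, hyP⟩ := armsC_not_pure hj (extHull_subset_of_coreKind hζ hk)
    (mem_farArms_iff.1 P.2).1
  exact ⟨e, y, hyP, h, ends_swap hey⟩

omit hj [DecidableEq E] in
/-- The u-arms are connected inside themselves. -/
lemma uArms_conn (ζ : Config E) (P : uArms ends h u p ζ) : ∀ x ∈ P.1, ∀ y ∈ P.1,
    y ∈ cluster ends (fun e => decide (e ∈ within ends P.1)) x := by
  obtain ⟨z, _, _, _, hPz⟩ := exists_of_mem_armsC (mem_uArms_iff.1 P.2).1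
  have : P.1 = armC ends h u ζ z := hPz
  rw [this]
  exact armC_conn ζ z

omit hj [DecidableEq E] in
/-- The far arms are connected inside themselves. -/
lemma farArms_conn (ζ : Config E) (P : farArms ends h u p ζ) : ∀ x ∈ P.1, ∀ y ∈ P.1,
    y ∈ cluster ends (fun e => decide (e ∈ within ends P.1)) x := by
  obtain ⟨z, _, _, _, hPz⟩ := exists_of_mem_armsC (mem_farArms_iff.1 P.2).1
  have : P.1 = armC ends h u ζ z := hPz
  rw [this]
  exact armC_conn ζ z

/-- **The h-piece is connected when `p` has a single partner inside the region**: `p` is a leaf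
of its arm, and removing a leaf keeps the arm connected. -/
theorem AhOf_conn_of_unique (huniq : ∃ y₀, ∀ e x, ends e = s(p, x) → x ∈ U → x ≠ u → x = y₀)
    {ζ : Config E} (hζ : ζ ∈ swOutSide ends l h o U ξ) (hk : CoreKind ends U h u ζ) :
    ∀ x ∈ AhOf ends h u p ζ, ∀ y ∈ AhOf ends h u p ζ,
      y ∈ cluster ends (fun e => decide (e ∈ within ends (AhOf ends h u p ζ))) x := by
  obtain ⟨y₀, hy₀⟩ := huniq
  have hHU := extHull_subset_of_coreKind hζ hk
  set A := AhOf ends h u p ζ with hA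
  -- every vertex of the h-piece is joined to `y₀` inside the h-piece
  have key : ∀ z ∈ armC ends h u ζ p, z = p ∨
      (y₀ ∈ A ∧ z ∈ cluster ends (fun e => decide (e ∈ within ends A)) y₀) := by
    intro z hz
    refine mem_of_conn_of_closed (ends := ends) (ω := armConfigC ends h u ζ)
      (S := {v | v = p ∨ (y₀ ∈ A ∧ v ∈ cluster ends (fun e => decide (e ∈ within ends A)) y₀)})
      ?_ (Or.inl rfl) hz
    intro a ha b hab
    obtain ⟨_, e, he, hends⟩ := openGraph_adj.1 hab
    obtain ⟨a', ha', b', hb', hab'⟩ := armConfigC_eq_true_iff.1 he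
    have haH : a ∈ extHull ends ζ h u \ {h, u} := by
      rw [hends, Sym2.eq_iff] at hab'
      rcases hab' with ⟨h1, _⟩ | ⟨h1, _⟩
      · rw [h1]; exact ha'
      · rw [h1]; exact hb'
    have hbH : b ∈ extHull ends ζ h u \ {h, u} := by
      rw [hends, Sym2.eq_iff] at hab'
      rcases hab' with ⟨_, h2⟩ | ⟨_, h2⟩
      · rw [h2]; exact hb'
      · rw [h2]; exact ha'
    have hbh : b ≠ h := fun h' => hbH.2 (by simp [h'])
    have hbu : b ≠ u := fun h' => hbH.2 (by simp [h'])
    by_cases hbp : b = p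
    · exact Or.inl hbp
    right
    -- `b` lies in the arm of `p`
    have hbA : b ∈ armC ends h u ζ p := by
      rcases ha with ha | ⟨_, ha⟩
      · rw [ha] at hends
        exact mem_armC_of_edge (mem_armC_self p) (p_mem_extHull hj.hup ζ) hj.hne_hp.symm
          hj.hne_up.symm hbH.1 hbh hbu hends
      · have haA : a ∈ A := cluster_within_subset ‹y₀ ∈ A› ha
        exact mem_armC_of_edge haA.1 haH.1 (fun h' => haH.2 (by simp [h']))
          (fun h' => haH.2 (by simp [h'])) hbH.1 hbh hbu hends
    rcases ha with ha | ⟨hy₀A, ha⟩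
    · -- the edge leaves `p`: its end is `y₀`
      rw [ha] at hends
      have hbU : b ∈ U := hHU hbH.1
      have hb₀ : b = y₀ := hy₀ e b hends hbU hbu
      have hy₀A : y₀ ∈ A := hb₀ ▸ ⟨hbA, hbp⟩
      exact ⟨hy₀A, hb₀ ▸ mem_cluster_self _ _ _⟩
    · refine ⟨hy₀A, ?_⟩
      have haA : a ∈ A := cluster_within_subset hy₀A ha
      have hin : (fun e => decide (e ∈ within ends A)) e = true := by
        simp only [decide_eq_true_eq]
        exact ⟨a, haA, b, ⟨hbA, hbp⟩, hends⟩
      exact mem_cluster_of_edge ha hin hends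
  intro x hx y hy
  rcases key x hx.1 with hxp | ⟨_, hx'⟩
  · exact absurd hxp hx.2
  rcases key y hy.1 with hyp | ⟨_, hy'⟩
  · exact absurd hyp hy.2
  exact conn_trans (conn_symm hx') hy'

/-- **At an escaping point of the raw cube the hull of `u` leaves the region**: through the
outside edge of `p` on the escaping cube, through a boundary edge of the h-piece at the pair. -/
theorem not_hull_u_subset_esc (hl : l ∉ U) (ho : o ∉ compU ends U h u p) {ζ : Config E}
    (hζ : ζ ∈ swOutSide ends l h o U ξ) (hk : CoreKind ends U h u ζ)
    (hdead : ∀ e x, ends e = s(p, x) → x ∈ AhOf ends h u p ζ → coreBaseOf ends ζ h u e = false)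
    {q : Pt (uArms ends h u p ζ) (farArms ends h u p ζ)} (hq : D q ∨ Pair q) :
    ¬ hull ends (mixedReal ends u p (fun P : uArms ends h u p ζ => P.1) (AhOf ends h u p ζ)
      (fun P : farArms ends h u p ζ => P.1) (coreBaseOf ends ζ h u) q) u ⊆ U := by
  have hb := mixedBase_of_coreKind hj hl hζ hk hdead
  set ζ' := mixedReal ends u p (fun P : uArms ends h u p ζ => P.1) (AhOf ends h u p ζ)
    (fun P : farArms ends h u p ζ => P.1) (coreBaseOf ends ζ h u) q with hζ'
  obtain ⟨eup, hup⟩ := hj.hup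
  have hupR : coreBaseOf ends ζ h u eup = true := hb.u_red eup p hup
  intro hsub
  rcases hq with ⟨hs, huP⟩ | ⟨hs, ha, huP⟩
  · -- the escaping cube: through the outside edge of `p`
    obtain ⟨ex, hex⟩ := exists_ext_edge hj hζ hk
    obtain ⟨z, hpz, hzu, hzA⟩ := hex
    have hzU : z ∉ U := ext_out hj hζ hk ex z hpz hzu hzA
    have hxB : coreBaseOf ends ζ h u ex = false := hb.ext_blue ex z hpz hzu hzA
    cases he : q.2.2.2.1 with
    | true =>
      -- `uP` blue, the outside edge blue
      have h1 : blue ζ' eup = true := by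
        rw [blue_eq_true_iff, hζ', hb.mixedReal_apply_UP hup, if_neg (by rw [huP, he]; decide), hupR]
        rfl
      have h2 : blue ζ' ex = true := by
        rw [blue_eq_true_iff, hζ', hb.mixedReal_apply_Ext ⟨z, hpz, hzu, hzA⟩, if_pos he, hxB]
      exact hzU (hsub (Or.inr (mem_cluster_of_edge (mem_cluster_of_edge (mem_cluster_self _ _ _)
        h1 hup) h2 hpz)))
    | false =>
      have h1 : ζ' eup = true := by
        rw [hζ', hb.mixedReal_apply_UP hup, if_pos (by rw [huP, he]; rfl), hupR]
      have h2 : ζ' ex = true := by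
        rw [hζ', hb.mixedReal_apply_Ext ⟨z, hpz, hzu, hzA⟩, if_neg (by rw [he]; decide), hxB]
        rfl
      exact hzU (hsub (Or.inl (mem_cluster_of_edge (mem_cluster_of_edge (mem_cluster_self _ _ _)
        h1 hup) h2 hpz)))
  · -- the pair: through a dead edge and a boundary edge of the h-piece
    obtain ⟨ed, y, hey, hyA⟩ := exists_dead_edge hj ζ
    obtain ⟨eb, z, hyz, hzh, hzu, hzp, hzarms, hzU⟩ := Ah_bdry hj ho hζ hk y hyA
    have hdB : coreBaseOf ends ζ h u ed = false := hdead ed y hey hyA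
    have hbB : coreBaseOf ends ζ h u eb = false :=
      hb.bdry_blue eb y z hyz (Or.inl (Or.inr hyA)) hzh hzu hzp hzarms
    have htd : ed ∈ touches ends (AhOf ends h u p ζ) := ⟨y, hyA, p, ends_swap hey⟩
    have htb : eb ∈ touches ends (AhOf ends h u p ζ) := ⟨y, hyA, z, hyz⟩
    cases he : q.2.2.2.1 with
    | true =>
      -- `x̄`: `uP` red, `a = false`: the dead and boundary edges red
      have h1 : ζ' eup = true := by
        rw [hζ', hb.mixedReal_apply_UP hup, if_pos (by rw [huP, he]), hupR]
      have h2 : ζ' ed = true := by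
        rw [hζ', hb.mixedReal_apply_Ah htd, if_neg (by rw [ha, he]; decide), hdB]
        rfl
      have h3 : ζ' eb = true := by
        rw [hζ', hb.mixedReal_apply_Ah htb, if_neg (by rw [ha, he]; decide), hbB]
        rfl
      exact hzU (hsub (Or.inl (mem_cluster_of_edge (mem_cluster_of_edge (mem_cluster_of_edge
        (mem_cluster_self _ _ _) h1 hup) h2 hey) h3 hyz)))
    | false =>
      -- `x`: `uP` blue, `a = true`: the dead and boundary edges blue
      have h1 : blue ζ' eup = true := by
        rw [blue_eq_true_iff, hζ', hb.mixedReal_apply_UP hup, if_neg (by rw [huP, he]; decide),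
          hupR]
        rfl
      have h2 : blue ζ' ed = true := by
        rw [blue_eq_true_iff, hζ', hb.mixedReal_apply_Ah htd, if_pos (by rw [ha, he]; rfl), hdB]
      have h3 : blue ζ' eb = true := by
        rw [blue_eq_true_iff, hζ', hb.mixedReal_apply_Ah htb, if_pos (by rw [ha, he]; rfl), hbB]
      exact hzU (hsub (Or.inr (mem_cluster_of_edge (mem_cluster_of_edge (mem_cluster_of_edge
        (mem_cluster_self _ _ _) h1 hup) h2 hey) h3 hyz)))

end BigBlock

end Summit.Ventures.PercRepro2
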